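import Literature.MathematicalPhysics.QuantumFieldTheory.ConformalBootstrap3D.PointKernelK34v2Data
import Literature.MathematicalPhysics.QuantumFieldTheory.ConformalBootstrap3D.PointKernelParts

/-!
# K34v2 certificate, kernel part file P40: one-cell head segments 150, 151 in level ranges

The head cells whose kernel evaluation exceeds one `decide` are one-cell segments of `hsegsK34v2`; each is
checked by `PCert.hPartSideOK` (side conditions) and `PCert.hPartOK` per level range `[n_lo, n_lo + count)`
against an integer claim, the claims summing to `≥ 0` (`PointKernel.partsOK`); soundness is
`PCert.hParts_sound` (`PointKernelParts`).  The part files `P1, P2, …` are mutually independent (each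
imports only the data file); the ranges of one cell may span several of them, and the per-cell
conclusions `hparts_i` / `hcell_i` of those cells are assembled in `PointKernelK34v2.lean`.
Estimated kernel time 240 s.
-/

set_option maxRecDepth 100000
set_option maxHeartbeats 0

namespace Literature.MathematicalPhysics.QuantumFieldTheory.ConformalBootstrap3D.PointKernelK34v2

open Literature.MathematicalPhysics.QuantumFieldTheory.ConformalBootstrap3D.PointKernel

/-- levels `[56, 61)` of segment 150: partial lower sum `≥` claim. [folklore] -/
theorem part_150_4 : certK34v2.hPartOK (PCert.segAt hsegsK34v2 150) JHK34v2 56 5 (728685581628635247714205209238060329) = true := by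
  decide +kernel

/-- levels `[61, 65)` of segment 150: partial lower sum `≥` claim. [folklore] -/
theorem part_150_5 : certK34v2.hPartOK (PCert.segAt hsegsK34v2 150) JHK34v2 61 4 (323790132365965367165435331389964963) = true := by
  decide +kernel

/-- one-cell segment 151 (row 6, cell `[14345/2048, 7173/1024]`, chord, `n_F = 64`,
6 level ranges): side conditions. [folklore] -/
theorem pside_151 : certK34v2.hPartSideOK (PCert.segAt hsegsK34v2 151) JHK34v2 = true := by
  decide +kernel

/-- its level ranges `(n_lo, count, claim)`. [folklore] -/
def parts_151 : List (ℕ × ℕ × ℤ) := [(0, 28, -33280765026351202314675942608229409356), (28, 12, 23672320282237955837208953504562243185), (40, 9, 6528490372251405806170668277235285993), (49, 7, 2073727279173302262254156848372871537), (56, 5, 705625664099283054654136675904063617), (61, 4, 300601428589255354388027302154945024)]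

/-- the ranges tile `[0, n_F]` and the claims sum to `≥ 0`. [folklore] -/
theorem pcov_151 : PointKernel.partsOK 64 parts_151 = true := by
  decide +kernel

/-- levels `[0, 28)` of segment 151: partial lower sum `≥` claim. [folklore] -/
theorem part_151_0 : certK34v2.hPartOK (PCert.segAt hsegsK34v2 151) JHK34v2 0 28 (-33280765026351202314675942608229409356) = true := by
  decide +kernel

/-- levels `[28, 40)` of segment 151: partial lower sum `≥` claim. [folklore] -/
theorem part_151_1 : certK34v2.hPartOK (PCert.segAt hsegsK34v2 151) JHK34v2 28 12 (23672320282237955837208953504562243185) = true := by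
  decide +kernel

end Literature.MathematicalPhysics.QuantumFieldTheory.ConformalBootstrap3D.PointKernelK34v2
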